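import Summits.MatrixMultiplication.MatrixMultiplication.Theorems.SnSubsetDichotomyHyperoctahedralThresholdReflectionSupply

/-!
# Forced reflection bouquets (hot co-cells) by pigeonhole on involution words, avoiding a forbidden set
(crux `HyperoctahedralThreshold`, refutation line, siege on `stub_poorRigidCore`, variation
"direct pigeonhole on involution words", seat k15 — multiplicity form of `stub_reflectionSupply`)

Three fixed-point-free involutions `μ b` of `Fin n`; words `List (Fin 3)` act on the right,
`x · z := z.foldl (fun v b => μ b v) x`.  For a colour `c` and a bit string `bs` of length `L` the explicit
reduced word `w = F c bs` (`w ++ [c]` reduced) gives the involution word `w ++ c :: w.reverse`, a conjugate of `μ c`,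
which moves every point.  PIGEONHOLE WITH MULTIPLICITY: the `2 ^ L` involution words of colour `c` and radius `L`
map a vertex `v` into the `n - 1` other points, so if `v` carries more than `M (n - 1)` of them whose trajectories
avoid `R`, more than `M` of those share their image `x` (`Finset.exists_lt_card_fiber_of_mul_lt_card_of_maps_to`).
By the bijection trick (for a fixed word and time the trajectory point is an injective function of the start) at
most `2^L (2L+2) |R|` pairs `(v, word)` meet `R`, so the hypothesis `M·n(n-1) + 2^L(2L+2)|R| < 2^L·n` provides such
a vertex.  The output — more than `M` distinct same-colour involution words with a common image pair `(v, x)` and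
`R`-free trajectories — is a BOUQUET of `C(M+1, 2)` reflection structures with common middle rung `{v, x}`
(crux NOTES §15.7, "hot rung / hot co-cell"): the supply side of the bouquet lemma (BQ) of `Lines/reflection_route_c3`,
forced at every radius `L ≥ log₂(M n)` and for every colour.  `M = 1` is `stub_reflectionSupply` (same colour).
Pure finite combinatorics; no definitions are introduced.
-/

set_option linter.dupNamespace false

namespace Summit.MatrixMultiplication.MatrixMultiplication.Theorems.HyperoctahedralThreshold.ReflectionBouquet

open Finset
open Summit.MatrixMultiplication.MatrixMultiplication.Theorems.HyperoctahedralThreshold.ReflectionSupply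

variable {n : ℕ}

/-! ## The `scanl` family seeded at an arbitrary colour `c` -/

/-- The words of the family seeded at `c` have length `L`. -/
theorem length_family_seed (c : Fin 3) {L : ℕ} (bs : List.Vector Bool L) :
    ((List.scanl (fun x b => if b then x + 1 else x + 2) c bs.toList).tail.reverse).length = L := by
  simp [List.length_scanl]

/-- The words `w` of the family seeded at `c` satisfy: `w ++ [c]` is reduced. -/
theorem isChain_family_seed (c : Fin 3) {L : ℕ} (bs : List.Vector Bool L) :
    List.IsChain (· ≠ ·)
      ((List.scanl (fun x b => if b then x + 1 else x + 2) c bs.toList).tail.reverse ++ [c]) := by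
  obtain ⟨l, hl⟩ := scanl_eq_cons c bs.toList
  have hc := isChain_scanl bs.toList c
  rw [hl] at hc ⊢
  have : (c :: l).tail.reverse ++ [c] = (c :: l).reverse := by simp
  rw [this, List.isChain_reverse]
  exact hc.imp (fun a b h => fun h' => h h'.symm)

/-- The family seeded at `c` is injective in the bit string. -/
theorem family_seed_injective (c : Fin 3) {L : ℕ} (bs bs' : List.Vector Bool L)
    (h : (List.scanl (fun x b => if b then x + 1 else x + 2) c bs.toList).tail.reverse =
      (List.scanl (fun x b => if b then x + 1 else x + 2) c bs'.toList).tail.reverse) : bs = bs' := by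
  obtain ⟨l, hl⟩ := scanl_eq_cons c bs.toList
  obtain ⟨l', hl'⟩ := scanl_eq_cons c bs'.toList
  have h1 := congrArg List.reverse h
  simp only [List.reverse_reverse] at h1
  rw [hl, hl'] at h1
  simp only [List.tail_cons] at h1
  subst h1
  exact List.Vector.toList_injective (scanl_injective _ _ _ (hl.trans hl'.symm))

/-! ## Forced bouquets -/

/-- **Forced `R`-avoiding reflection bouquet of colour `c` (pigeonhole with multiplicity + bijection trick).**
If `M·n(n-1) + 2^L(2L+2)|R| < 2^L·n` then some vertex `v` and some point `x` carry a set `S` of more than `M`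
distinct reduced words `w` of length `L` (`w ++ [c]` reduced) whose involution words `w ++ c :: w.reverse` all map
`v` to `x` and whose trajectories from `v` avoid `R`. -/
theorem exists_reflection_bouquet_avoiding (μ : Fin 3 → Equiv.Perm (Fin n)) (hμ : ∀ c, μ c * μ c = 1)
    (hfpf : ∀ c v, μ c v ≠ v) (c : Fin 3) {L M : ℕ} (R : Finset (Fin n))
    (hL : M * (n * (n - 1)) + 2 ^ L * ((2 * L + 2) * R.card) < 2 ^ L * n) :
    ∃ (v x : Fin n) (S : Finset (List (Fin 3))), M < S.card ∧ ∀ w ∈ S,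
      w.length = L ∧ List.IsChain (· ≠ ·) (w ++ [c]) ∧
      (w ++ c :: w.reverse).foldl (fun v b => μ b v) v = x ∧
      (∀ t : ℕ, ((w ++ c :: w.reverse).take t).foldl (fun v b => μ b v) v ∉ R) := by
  classical
  set F : List.Vector Bool L → List (Fin 3) := fun bs =>
    (List.scanl (fun x b => if b then x + 1 else x + 2) c bs.toList).tail.reverse with hF
  -- the involution word of `bs` and its trajectory points
  set ι : List.Vector Bool L → List (Fin 3) := fun bs => F bs ++ c :: (F bs).reverse with hι
  have hιlen : ∀ bs, (ι bs).length = 2 * L + 1 := by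
    intro bs
    have h := length_family_seed c bs
    simp only [hι, hF, List.length_append, List.length_cons, List.length_reverse] at h ⊢
    omega
  -- good pairs: the first `2L+2` trajectory points avoid `R`
  set good : Fin n → List.Vector Bool L → Prop := fun v bs =>
    ∀ t, t < 2 * L + 2 → ((ι bs).take t).foldl (fun v b => μ b v) v ∉ R with hgood
  -- (1) for fixed `bs, t` at most `|R|` starting points have their `t`-th point in `R`
  have hfib : ∀ (bs : List.Vector Bool L) (t : ℕ),
      ((Finset.univ : Finset (Fin n)).filter
        (fun v => ((ι bs).take t).foldl (fun v b => μ b v) v ∈ R)).card ≤ R.card := by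
    intro bs t
    refine Finset.card_le_card_of_injOn (fun v => ((ι bs).take t).foldl (fun v b => μ b v) v) ?_ ?_
    · intro v hv
      simpa using hv
    · intro v _ v' _ hvv'
      exact foldl_perm_injective μ _ hvv'
  -- (2) the bad pairs are few in total
  have hbad : ∑ v : Fin n, ((Finset.univ : Finset (List.Vector Bool L)).filter (fun bs => ¬ good v bs)).card
      ≤ 2 ^ L * ((2 * L + 2) * R.card) := by
    calc ∑ v : Fin n, ((Finset.univ : Finset (List.Vector Bool L)).filter (fun bs => ¬ good v bs)).card
        ≤ ∑ v : Fin n, ∑ bs : List.Vector Bool L, ∑ t ∈ Finset.range (2 * L + 2),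
            (if ((ι bs).take t).foldl (fun v b => μ b v) v ∈ R then 1 else 0) := by
          refine Finset.sum_le_sum fun v _ => ?_
          rw [Finset.card_filter]
          refine Finset.sum_le_sum fun bs _ => ?_
          by_cases hb : ¬ good v bs
          · rw [if_pos hb]
            simp only [hgood, not_forall, not_not, exists_prop] at hb
            obtain ⟨t, ht, htR⟩ := hb
            have h1 := Finset.single_le_sum (f := fun t =>
              if ((ι bs).take t).foldl (fun v b => μ b v) v ∈ R then 1 else 0)
              (fun _ _ => Nat.zero_le _) (Finset.mem_range.2 ht)
            rw [if_pos htR] at h1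
            exact h1
          · rw [if_neg hb]
            exact Nat.zero_le _
      _ = ∑ bs : List.Vector Bool L, ∑ t ∈ Finset.range (2 * L + 2), ∑ v : Fin n,
            (if ((ι bs).take t).foldl (fun v b => μ b v) v ∈ R then 1 else 0) := by
          rw [Finset.sum_comm]
          refine Finset.sum_congr rfl fun bs _ => ?_
          rw [Finset.sum_comm]
      _ ≤ ∑ bs : List.Vector Bool L, ∑ t ∈ Finset.range (2 * L + 2), R.card := by
          refine Finset.sum_le_sum fun bs _ => Finset.sum_le_sum fun t _ => ?_
          rw [← Finset.card_filter]
          exact hfib bs t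
      _ = 2 ^ L * ((2 * L + 2) * R.card) := by
          simp [Finset.sum_const, Finset.card_univ, card_vector, Fintype.card_bool]
  -- (3) some vertex has more than `M (n - 1)` good words
  have hv : ∃ v : Fin n, M * (n - 1) <
      ((Finset.univ : Finset (List.Vector Bool L)).filter (fun bs => good v bs)).card := by
    by_contra hcon
    push Not at hcon
    have hsplit : ∀ v : Fin n,
        ((Finset.univ : Finset (List.Vector Bool L)).filter (fun bs => good v bs)).card +
          ((Finset.univ : Finset (List.Vector Bool L)).filter (fun bs => ¬ good v bs)).card = 2 ^ L := by
      intro v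
      rw [Finset.card_filter_add_card_filter_not, Finset.card_univ, card_vector, Fintype.card_bool]
    have hsum : ∑ v : Fin n, (2 ^ L) ≤ n * (M * (n - 1)) + 2 ^ L * ((2 * L + 2) * R.card) := by
      calc ∑ v : Fin n, (2 ^ L)
          = ∑ v : Fin n, (((Finset.univ : Finset (List.Vector Bool L)).filter (fun bs => good v bs)).card +
              ((Finset.univ : Finset (List.Vector Bool L)).filter (fun bs => ¬ good v bs)).card) := by
            refine Finset.sum_congr rfl fun v _ => (hsplit v).symm
        _ = ∑ v : Fin n, ((Finset.univ : Finset (List.Vector Bool L)).filter (fun bs => good v bs)).card +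
              ∑ v : Fin n, ((Finset.univ : Finset (List.Vector Bool L)).filter (fun bs => ¬ good v bs)).card :=
            Finset.sum_add_distrib
        _ ≤ ∑ v : Fin n, (M * (n - 1)) + 2 ^ L * ((2 * L + 2) * R.card) :=
            Nat.add_le_add (Finset.sum_le_sum fun v _ => hcon v) hbad
        _ = n * (M * (n - 1)) + 2 ^ L * ((2 * L + 2) * R.card) := by
            simp [Finset.sum_const, Finset.card_univ, Fintype.card_fin]
    have h1 : ∑ v : Fin n, (2 ^ L) = 2 ^ L * n := by
      simp [Finset.sum_const, Finset.card_univ, Fintype.card_fin, mul_comm]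
    have h2 : n * (M * (n - 1)) = M * (n * (n - 1)) := by ring
    omega
  obtain ⟨v, hv⟩ := hv
  -- (4) pigeonhole with multiplicity among the good words at `v`
  have hmaps : ∀ bs ∈ (Finset.univ : Finset (List.Vector Bool L)).filter (fun bs => good v bs),
      (fun bs => (ι bs).foldl (fun v b => μ b v) v) bs ∈ (Finset.univ : Finset (Fin n)).erase v := by
    intro bs _
    simp only [Finset.mem_erase, Finset.mem_univ, and_true]
    exact foldl_invWord_ne_self μ hμ hfpf _ _ _
  have hcard : ((Finset.univ : Finset (Fin n)).erase v).card * M <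
      ((Finset.univ : Finset (List.Vector Bool L)).filter (fun bs => good v bs)).card := by
    rw [Finset.card_erase_of_mem (Finset.mem_univ v), Finset.card_univ, Fintype.card_fin]
    rw [mul_comm]
    exact hv
  obtain ⟨x, -, hx⟩ := Finset.exists_lt_card_fiber_of_mul_lt_card_of_maps_to hmaps hcard
  -- the fibre over `x` and its image under the (injective) word family
  set Φ := ((Finset.univ : Finset (List.Vector Bool L)).filter (fun bs => good v bs)).filter
    (fun bs => (ι bs).foldl (fun v b => μ b v) v = x) with hΦ
  have hinj : Set.InjOn F ↑Φ := by
    intro bs _ bs' _ hFF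
    exact family_seed_injective c bs bs' hFF
  -- from the first `2L+2` points to all `t`
  have hall : ∀ bs, good v bs → ∀ t, ((ι bs).take t).foldl (fun v b => μ b v) v ∉ R := by
    intro bs hg t
    by_cases ht : t < 2 * L + 2
    · exact hg t ht
    · have h1 : (ι bs).take t = ι bs := List.take_of_length_le (by rw [hιlen]; omega)
      have h2 : (ι bs).take (2 * L + 1) = ι bs := List.take_of_length_le (by rw [hιlen])
      rw [h1, ← h2]
      exact hg (2 * L + 1) (by omega)
  refine ⟨v, x, Φ.image F, ?_, ?_⟩
  · rw [Finset.card_image_of_injOn hinj]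
    exact hx
  · intro w hw
    rw [Finset.mem_image] at hw
    obtain ⟨bs, hbs, rfl⟩ := hw
    rw [hΦ, Finset.mem_filter, Finset.mem_filter] at hbs
    obtain ⟨⟨-, hg⟩, hbx⟩ := hbs
    exact ⟨length_family_seed c bs, isChain_family_seed c bs, hbx, hall bs hg⟩

/-- **Helper stub `stub_reflectionBouquet`** (crux stmt-MatrixMultiplication-10883, refutation line
`refutation_local_symmetry`, reflection sub-route; supply side of the bouquet lemma (BQ) with the forbidden set built in):
for three fixed-point-free involutions of `Fin n`, a colour `c`, a forbidden set `R`, a radius `L` and a multiplicity `M`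
with `M·n(n-1) + 2^L(2L+2)|R| < 2^L·n`, some vertex `v` and point `x` carry more than `M` distinct same-colour involution
words of radius `L` mapping `v` to `x`, all with `R`-free trajectories — verbatim `exists_reflection_bouquet_avoiding`. -/
theorem stub_reflectionBouquet : ∀ (n L M : ℕ) (μ : Fin 3 → Equiv.Perm (Fin n)) (R : Finset (Fin n)) (c : Fin 3), (∀ b, μ b * μ b = 1) → (∀ b v, μ b v ≠ v) → M * (n * (n - 1)) + 2 ^ L * ((2 * L + 2) * R.card) < 2 ^ L * n → ∃ (v x : Fin n) (S : Finset (List (Fin 3))), M < S.card ∧ ∀ w ∈ S, w.length = L ∧ List.IsChain (· ≠ ·) (w ++ [c]) ∧ (w ++ c :: w.reverse).foldl (fun v b => μ b v) v = x ∧ ∀ t : ℕ, ((w ++ c :: w.reverse).take t).foldl (fun v b => μ b v) v ∉ R :=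
  fun _n _L _M μ R c hμ hfpf hL => exists_reflection_bouquet_avoiding μ hμ hfpf c R hL

end Summit.MatrixMultiplication.MatrixMultiplication.Theorems.HyperoctahedralThreshold.ReflectionBouquet
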